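import Literature.Computability.QuantumComplexity.GramSchmidtTableMachine
import Literature.Computability.QuantumComplexity.GramSchmidtRounding
import HarnessLib

/-!
# The rounded exact Gram–Schmidt unit matrix is polynomial time (typed `FP` on codes)

Family `quantum-advantage`, machine side of the discharge of Aaronson–Arkhipov's Thm. 1.3
(`gpeSolvableInFBPPRel_NPRel_of_approxBosonSamplingOracle`), sequel of
`GramSchmidtTableMachine.lean` (Cohen's integer table `levelsOf` is typed polynomial time) and
`GramSchmidtRounding.lean` (the list program `roundedGS b rows n`: the `b`-bit roundings of the
exactly column-orthonormal `gsUnit (gaussIntMatrix B)`, computed with integers only). Here that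
list program is assembled in the typed algebra `CodeFP` (`CodeFP.lean`, `CodeFPArith.lean`):

* `reColL_codeFP`, `imColL_codeFP`, `dblRowsL_codeFP`, `stdRowsL_codeFP`, `extRowsL_codeFP`,
  `gsLevels_codeFP` (the extended rows and their table);
* `ceilSqrtDiv_codeFP`, `floorTwoMulDivSqrt_codeFP`, `roundDivSqrt_codeFP`, `roundGS_codeFP` (the
  integer rounding of `IntegerRoundSqrt.lean`: `Nat.sqrt`, divisions and tests only);
* `entryOf_codeFP` and **`roundedGS_codeFP`** —
  `(1ᵇ, 1ⁿ, rows) ↦ roundedGS b rows n` is typed polynomial time (Gaussian integers in the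
  difference-pair code `giE = pairE intE intE`).

All proved; no machine is written.

## References

* S. Aaronson, A. Arkhipov, *The computational complexity of linear optics*, Theory of Computing 9
  (2013) 143–252, §5.2 (p. 192: `A` by Gram–Schmidt orthonormalisation; p. 195, the hiding procedure
  in `BPP`) and §2 (p. 161).
* H. Cohen, *A Course in Computational Algebraic Number Theory*, GTM 138, Springer 1993,
  Algorithms 1.7.1 and 2.6.7.
* S. Arora, B. Barak, *Computational Complexity: A Modern Approach*, CUP 2009, §1.3.
-/

namespace Literature.Computability.QuantumComplexity

open Literature.Computability.Complexity Literature.Computability.Complexity.CodeFP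
  Literature.Algebra.EuclideanLattices Literature.Analysis.SpecialFunctions Polynomial

/-- Gaussian integers in the difference-pair code. [folklore] -/
abbrev giE : ℤ × ℤ → List Bool := pairE intE intE

/-! ### The extended rows -/

/-- An entry of a row with the default `(0, 0)`: `(c, row) ↦ row[c]`. [folklore] -/
theorem rowGetD_codeFP : CodeFP (pairE natE (rawE giE)) giE (fun p => p.2.getD p.1 (0, 0)) := by
  exact ((rawGetOr giE).comp ((snd _ _).pair ((fst _ _).pair (const _ ((0, 0) : ℤ × ℤ)))) :)

/-- `(rows, c) ↦ reColL rows c` is typed polynomial time. [folklore] -/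
theorem reColL_codeFP : CodeFP (pairE (rawE (rawE giE)) natE) (rawE intE) (fun p => reColL p.1 p.2) := by
  have h1 : CodeFP (pairE natE (rawE (rawE giE))) (rawE intE) (fun p => p.2.map fun row => (row.getD p.1 (0, 0)).1) := by
    exact (map rowGetD_codeFP.fst' :)
  have h2 : CodeFP (pairE natE (rawE (rawE giE))) (rawE intE) (fun p => p.2.map fun row => (row.getD p.1 (0, 0)).2) := by
    exact (map rowGetD_codeFP.snd' :)
  have hsw : CodeFP (pairE (rawE (rawE giE)) natE) (pairE natE (rawE (rawE giE))) (fun p => (p.2, p.1)) := by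
    exact ((snd _ _).pair (fst _ _) :)
  exact ((rawAppend intE).comp ((h1.comp hsw).pair (h2.comp hsw)) :)

/-- `(rows, c) ↦ imColL rows c` is typed polynomial time. [folklore] -/
theorem imColL_codeFP : CodeFP (pairE (rawE (rawE giE)) natE) (rawE intE) (fun p => imColL p.1 p.2) := by
  have hneg : CodeFP (pairE natE (rawE giE)) intE (fun p => -(p.2.getD p.1 (0, 0)).2) := by
    exact (intNeg.comp rowGetD_codeFP.snd' :)
  have h1 : CodeFP (pairE natE (rawE (rawE giE))) (rawE intE) (fun p => p.2.map fun row => -(row.getD p.1 (0, 0)).2) := by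
    exact (map hneg :)
  have h2 : CodeFP (pairE natE (rawE (rawE giE))) (rawE intE) (fun p => p.2.map fun row => (row.getD p.1 (0, 0)).1) := by
    exact (map rowGetD_codeFP.fst' :)
  have hsw : CodeFP (pairE (rawE (rawE giE)) natE) (pairE natE (rawE (rawE giE))) (fun p => (p.2, p.1)) := by
    exact ((snd _ _).pair (fst _ _) :)
  exact ((rawAppend intE).comp ((h1.comp hsw).pair (h2.comp hsw)) :)

/-- `(1ⁿ, rows) ↦ dblRowsL rows n` is typed polynomial time. [folklore] -/
theorem dblRowsL_codeFP : CodeFP (pairE unE (rawE (rawE giE))) (rawE (rawE intE)) (fun p => dblRowsL p.2 p.1) := by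
  have hitem : CodeFP (pairE (rawE (rawE giE)) natE) (rawE (rawE intE)) (fun p => [reColL p.1 p.2, imColL p.1 p.2]) := by
    exact ((rawCons (rawE intE)).comp (reColL_codeFP.pair ((rawSingleton (rawE intE)).comp imColL_codeFP)) :)
  have hmap : CodeFP (pairE (rawE (rawE giE)) (rawE natE)) (rawE (rawE (rawE intE)))
      (fun p => p.2.map fun c => [reColL p.1 c, imColL p.1 c]) := by
    exact (map hitem :)
  exact (((flatten (rawE intE)).comp (hmap.comp ((snd _ _).pair (urange.comp (fst _ _))))).congr fun p => rfl :)

/-- The indicator entry `(t, s) ↦ [s = t]`. [folklore] -/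
theorem stdEntry_codeFP : CodeFP (pairE natE natE) intE (fun p => if decide (p.2 = p.1) then (1 : ℤ) else 0) := by
  have ht : CodeFP (pairE natE natE) bitE (fun p => decide (p.2 = p.1)) := by
    exact (natEq.comp ((snd _ _).pair (fst _ _)) :)
  exact (ht.ite (const _ (1 : ℤ)) (const _ (0 : ℤ)) :)

/-- `1ᴰ ↦ stdRowsL D` is typed polynomial time. [folklore] -/
theorem stdRowsL_codeFP : CodeFP unE (rawE (rawE intE)) stdRowsL := by
  -- inner: context `(rangeD, t)`... we use context `t` over the list `rangeD`
  have hinner : CodeFP (pairE natE (rawE natE)) (rawE intE)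
      (fun p => p.2.map fun s => if decide (s = p.1) then (1 : ℤ) else 0) := by
    exact (map stdEntry_codeFP :)
  -- outer: context `rangeD`, item `t`
  have houter : CodeFP (pairE (rawE natE) (rawE natE)) (rawE (rawE intE))
      (fun p => p.2.map fun t => p.1.map fun s => if decide (s = t) then (1 : ℤ) else 0) := by
    exact (map (hinner.comp ((snd _ _).pair (fst _ _))) :)
  refine ((houter.comp (urange.pair urange)).congr fun D => ?_ :)
  simp only [stdRowsL]
  apply List.map_congr_left
  intro t _
  apply List.map_congr_left
  intro s _
  by_cases h : s = t <;> simp [h]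

/-- `(1ⁿ, 1ᴰ, rows) ↦ extRowsL rows n D` is typed polynomial time. [folklore] -/
theorem extRowsL_codeFP : CodeFP (pairE unE (pairE unE (rawE (rawE giE)))) (rawE (rawE intE))
    (fun p => extRowsL p.2.2 p.1 p.2.1) := by
  have hd : CodeFP (pairE unE (pairE unE (rawE (rawE giE)))) (rawE (rawE intE)) (fun p => dblRowsL p.2.2 p.1) := by
    exact (dblRowsL_codeFP.comp ((fst _ _).pair (snd _ _).snd') :)
  have hs : CodeFP (pairE unE (pairE unE (rawE (rawE giE)))) (rawE (rawE intE)) (fun p => stdRowsL p.2.1) := by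
    exact (stdRowsL_codeFP.comp (snd _ _).fst' :)
  exact ((rawAppend (rawE intE)).comp (hd.pair hs) :)

/-- `(1ⁿ, 1ᴰ, rows) ↦ gsLevels rows n D` is typed polynomial time. [cite: Cohen1993, Algorithm 2.6.7] -/
theorem gsLevels_codeFP : CodeFP (pairE unE (pairE unE (rawE (rawE giE)))) (rawE (pairE intE (rawE (rawE intE))))
    (fun p => gsLevels p.2.2 p.1 p.2.1) := by
  have h2n : CodeFP (pairE unE (pairE unE (rawE (rawE giE)))) unE (fun p => p.1 + p.1) := by
    exact (unAdd.comp ((fst _ _).pair (fst _ _)) :)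
  refine ((levelsOf_codeFP.comp (h2n.pair (h2n.pair extRowsL_codeFP))).congr fun p => ?_ :)
  simp only [gsLevels, two_mul]

/-! ### The integer rounding -/

/-- `(a, D) ↦ ceilSqrtDiv a D` is typed polynomial time. [folklore] -/
theorem ceilSqrtDiv_codeFP : CodeFP (pairE natE natE) natE (fun p => ceilSqrtDiv p.1 p.2) := by
  have ht : CodeFP (pairE natE natE) natE (fun p => (p.1 + p.2 - 1) / p.2) := by
    have h1 : CodeFP (pairE natE natE) natE (fun p => p.1 + p.2 - 1) := by
      exact (natSub.comp ((natAdd.comp ((fst _ _).pair (snd _ _))).pair (const _ 1)) :)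
    exact (natDiv.comp (h1.pair (snd _ _)) :)
  have hz : CodeFP (pairE natE natE) bitE (fun p => decide ((p.1 + p.2 - 1) / p.2 = 0)) := by
    exact (natEq.comp (ht.pair (const _ 0)) :)
  have hs : CodeFP (pairE natE natE) natE (fun p => Nat.sqrt ((p.1 + p.2 - 1) / p.2 - 1) + 1) := by
    exact (natAdd.comp ((natSqrt.comp (natSub.comp (ht.pair (const _ 1)))).pair (const _ 1)) :)
  refine ((hz.ite (const _ 0) hs).congr fun p => ?_ :)
  unfold ceilSqrtDiv
  by_cases h : (p.1 + p.2 - 1) / p.2 = 0 <;> simp [h]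

/-- `(x, D) ↦ floorTwoMulDivSqrt x D` is typed polynomial time. [folklore] -/
theorem floorTwoMulDivSqrt_codeFP : CodeFP (pairE intE natE) intE (fun p => floorTwoMulDivSqrt p.1 p.2) := by
  have ha : CodeFP (pairE intE natE) natE (fun p => 4 * p.1.natAbs ^ 2) := by
    have hn : CodeFP (pairE intE natE) natE (fun p => p.1.natAbs) := by exact (intNatAbs.comp (fst _ _) :)
    refine ((natMul.comp ((const _ 4).pair (natMul.comp (hn.pair hn)))).congr fun p => ?_ :)
    simp only [pow_two]
  have hpos : CodeFP (pairE intE natE) intE (fun p => ((Nat.sqrt (4 * p.1.natAbs ^ 2 / p.2) : ℕ) : ℤ)) := by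
    exact (intOfNat.comp (natSqrt.comp (natDiv.comp (ha.pair (snd _ _)))) :)
  have hneg : CodeFP (pairE intE natE) intE (fun p => -((ceilSqrtDiv (4 * p.1.natAbs ^ 2) p.2 : ℕ) : ℤ)) := by
    exact (intNeg.comp (intOfNat.comp (ceilSqrtDiv_codeFP.comp (ha.pair (snd _ _)))) :)
  have hc : CodeFP (pairE intE natE) bitE (fun p => decide (0 ≤ p.1)) := by
    exact (intLe.comp ((const _ (0 : ℤ)).pair (fst _ _)) :)
  refine ((hc.ite hpos hneg).congr fun p => ?_ :)
  unfold floorTwoMulDivSqrt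
  by_cases h : 0 ≤ p.1 <;> simp [h]

/-- `(x, D) ↦ roundDivSqrt x D` is typed polynomial time. [folklore] -/
theorem roundDivSqrt_codeFP : CodeFP (pairE intE natE) intE (fun p => roundDivSqrt p.1 p.2) := by
  have h1 : CodeFP (pairE intE natE) intE (fun p => floorTwoMulDivSqrt p.1 p.2 + 1) := by
    exact (intAdd.comp (floorTwoMulDivSqrt_codeFP.pair (const _ (1 : ℤ))) :)
  exact ((intEDiv.comp (h1.pair (const _ (2 : ℤ)))).congr fun p => rfl :)

/-- `((x, d, d'), P) ↦ roundGS x d d' P` is typed polynomial time. [folklore] -/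
theorem roundGS_codeFP : CodeFP (pairE (pairE intE (pairE intE intE)) natE) intE
    (fun p => roundGS p.1.1 p.1.2.1 p.1.2.2 p.2) := by
  have hx : CodeFP (pairE (pairE intE (pairE intE intE)) natE) intE (fun p => (p.2 : ℤ) * p.1.1) := by
    exact (intMul.comp ((intOfNat.comp (snd _ _)).pair (fst _ _).fst') :)
  have hD : CodeFP (pairE (pairE intE (pairE intE intE)) natE) natE (fun p => (p.1.2.1 * p.1.2.2).toNat) := by
    exact (intToNat.comp (intMul.comp ((fst _ _).snd'.fst'.pair (fst _ _).snd'.snd')) :)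
  exact ((roundDivSqrt_codeFP.comp (hx.pair hD)).congr fun p => rfl :)

/-! ### The rounded entries -/

/-- The context of `entryOf`: `(P, Ls, n, m)`. [folklore] -/
abbrev entryCtxE : ℕ × List (ℤ × List (List ℤ)) × ℕ × ℕ → List Bool :=
  pairE natE (pairE (rawE (pairE intE (rawE (rawE intE)))) (pairE natE natE))

/-- The argument of `entryOf`: `((P, Ls, n, m), r, c)`. [folklore] -/
abbrev entryArgE : (ℕ × List (ℤ × List (List ℤ)) × ℕ × ℕ) × ℕ × ℕ → List Bool :=
  pairE entryCtxE (pairE natE natE)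

/-- `((P, Ls, n, m), r, c) ↦ entryOf P Ls n m r c` is typed polynomial time. [folklore] -/
theorem entryOf_codeFP : CodeFP entryArgE giE (fun q => entryOf q.1.1 q.1.2.1 q.1.2.2.1 q.1.2.2.2 q.2.1 q.2.2) := by
  have hP : CodeFP entryArgE natE (fun q => q.1.1) := (fst _ _).fst'
  have hLs : CodeFP entryArgE (rawE (pairE intE (rawE (rawE intE)))) (fun q => q.1.2.1) := (fst _ _).snd'.fst'
  have hn : CodeFP entryArgE natE (fun q => q.1.2.2.1) := (fst _ _).snd'.snd'.fst'
  have hm : CodeFP entryArgE natE (fun q => q.1.2.2.2) := (fst _ _).snd'.snd'.snd'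
  have hr : CodeFP entryArgE natE (fun q => q.2.1) := (snd _ _).fst'
  have hc : CodeFP entryArgE natE (fun q => q.2.2) := (snd _ _).snd'
  have h2c : CodeFP entryArgE natE (fun q => 2 * q.2.2) := by exact (natMul.comp ((const _ 2).pair hc) :)
  have h2c1 : CodeFP entryArgE natE (fun q => 2 * q.2.2 + 1) := by exact (natAdd.comp (h2c.pair (const _ 1)) :)
  -- the two levels read off the list
  have hget : CodeFP (pairE (rawE (pairE intE (rawE (rawE intE)))) natE) (pairE intE (rawE (rawE intE)))
      (fun t => t.1.getD t.2 ((0 : ℤ), ([] : List (List ℤ)))) := by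
    exact ((rawGetOr (pairE intE (rawE (rawE intE)))).comp
      ((fst _ _).pair ((snd _ _).pair (const _ (((0 : ℤ), ([] : List (List ℤ))))))) :)
  have hL0 : CodeFP entryArgE (pairE intE (rawE (rawE intE))) (fun q => q.1.2.1.getD (2 * q.2.2) (0, [])) := by
    exact (hget.comp (hLs.pair h2c) :)
  have hL1 : CodeFP entryArgE (pairE intE (rawE (rawE intE))) (fun q => q.1.2.1.getD (2 * q.2.2 + 1) (0, [])) := by
    exact (hget.comp (hLs.pair h2c1) :)
  have hd : CodeFP entryArgE intE (fun q => (q.1.2.1.getD (2 * q.2.2) (0, [])).1) := hL0.fst'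
  have hT : CodeFP entryArgE (rawE (rawE intE)) (fun q => (q.1.2.1.getD (2 * q.2.2) (0, [])).2) := hL0.snd'
  have hd' : CodeFP entryArgE intE (fun q => (q.1.2.1.getD (2 * q.2.2 + 1) (0, [])).1) := hL1.fst'
  -- the two table entries
  have hi1 : CodeFP entryArgE natE (fun q => 2 * q.1.2.2.1 + q.2.1) := by
    exact (natAdd.comp ((natMul.comp ((const _ 2).pair hn)).pair hr) :)
  have hi2 : CodeFP entryArgE natE (fun q => 2 * q.1.2.2.1 + q.1.2.2.2 + q.2.1) := by
    exact (natAdd.comp ((natAdd.comp ((natMul.comp ((const _ 2).pair hn)).pair hm)).pair hr) :)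
  have hu1 : CodeFP entryArgE intE (fun q => tabEntry (q.1.2.1.getD (2 * q.2.2) (0, [])).2 (2 * q.1.2.2.1 + q.2.1) (2 * q.2.2)) := by
    exact (tabEntry_codeFP.comp (hT.pair (hi1.pair h2c)) :)
  have hu2 : CodeFP entryArgE intE
      (fun q => tabEntry (q.1.2.1.getD (2 * q.2.2) (0, [])).2 (2 * q.1.2.2.1 + q.1.2.2.2 + q.2.1) (2 * q.2.2)) := by
    exact (tabEntry_codeFP.comp (hT.pair (hi2.pair h2c)) :)
  have he1 : CodeFP entryArgE intE (fun q => roundGS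
      (tabEntry (q.1.2.1.getD (2 * q.2.2) (0, [])).2 (2 * q.1.2.2.1 + q.2.1) (2 * q.2.2))
      (q.1.2.1.getD (2 * q.2.2) (0, [])).1 (q.1.2.1.getD (2 * q.2.2 + 1) (0, [])).1 q.1.1) := by
    exact (roundGS_codeFP.comp ((hu1.pair (hd.pair hd')).pair hP) :)
  have he2 : CodeFP entryArgE intE (fun q => roundGS
      (tabEntry (q.1.2.1.getD (2 * q.2.2) (0, [])).2 (2 * q.1.2.2.1 + q.1.2.2.2 + q.2.1) (2 * q.2.2))
      (q.1.2.1.getD (2 * q.2.2) (0, [])).1 (q.1.2.1.getD (2 * q.2.2 + 1) (0, [])).1 q.1.1) := by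
    exact (roundGS_codeFP.comp ((hu2.pair (hd.pair hd')).pair hP) :)
  exact ((he1.pair he2).congr fun q => rfl :)

/-- **The rounded exact Gram–Schmidt unit matrix is typed polynomial time**:
`(1ᵇ, 1ⁿ, rows) ↦ roundedGS b rows n`. [cite: AaronsonArkhipovToC2013, §5.2 (p. 192) with §2 (p. 161)] -/
theorem roundedGS_codeFP : CodeFP (pairE unE (pairE unE (rawE (rawE giE)))) (rawE (rawE giE))
    (fun p => roundedGS p.1 p.2.2 p.2.1) := by
  -- the pieces of the context
  have hb : CodeFP (pairE unE (pairE unE (rawE (rawE giE)))) unE (fun p => p.1) := fst _ _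
  have hn : CodeFP (pairE unE (pairE unE (rawE (rawE giE)))) unE (fun p => p.2.1) := (snd _ _).fst'
  have hrows : CodeFP (pairE unE (pairE unE (rawE (rawE giE)))) (rawE (rawE giE)) (fun p => p.2.2) := (snd _ _).snd'
  have hm : CodeFP (pairE unE (pairE unE (rawE (rawE giE)))) unE (fun p => p.2.2.length) := by
    exact ((ulength _).comp hrows :)
  have hP : CodeFP (pairE unE (pairE unE (rawE (rawE giE)))) natE (fun p => 2 ^ p.1) := by
    exact (natPow.comp ((const _ 2).pair hb) :)
  have hLs : CodeFP (pairE unE (pairE unE (rawE (rawE giE)))) (rawE (pairE intE (rawE (rawE intE))))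
      (fun p => gsLevels p.2.2 p.2.1 (p.2.2.length + p.2.2.length)) := by
    exact (gsLevels_codeFP.comp (hn.pair ((unAdd.comp (hm.pair hm)).pair hrows)) :)
  have hctx : CodeFP (pairE unE (pairE unE (rawE (rawE giE)))) entryCtxE
      (fun p => (2 ^ p.1, gsLevels p.2.2 p.2.1 (p.2.2.length + p.2.2.length), p.2.1, p.2.2.length)) := by
    exact (hP.pair (hLs.pair ((natOfUn.comp hn).pair (natOfUn.comp hm))) :)
  -- inner map over `c ∈ range n` with context `(ctx, r)`; outer map over `r ∈ range m` with context `(ctx, rangeN)`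
  have hinner : CodeFP (pairE (pairE entryCtxE natE) (rawE natE)) (rawE giE)
      (fun t => t.2.map fun c => entryOf t.1.1.1 t.1.1.2.1 t.1.1.2.2.1 t.1.1.2.2.2 t.1.2 c) := by
    exact (map (entryOf_codeFP.comp ((fst _ _).fst'.pair ((fst _ _).snd'.pair (snd _ _)))) :)
  have hrowFn : CodeFP (pairE (pairE entryCtxE (rawE natE)) natE) (rawE giE)
      (fun t => t.1.2.map fun c => entryOf t.1.1.1 t.1.1.2.1 t.1.1.2.2.1 t.1.1.2.2.2 t.2 c) := by
    exact (hinner.comp (((fst _ _).fst'.pair (snd _ _)).pair (fst _ _).snd') :)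
  have houter : CodeFP (pairE (pairE entryCtxE (rawE natE)) (rawE natE)) (rawE (rawE giE))
      (fun t => t.2.map fun r => t.1.2.map fun c => entryOf t.1.1.1 t.1.1.2.1 t.1.1.2.2.1 t.1.1.2.2.2 r c) := by
    exact (map hrowFn :)
  have hall : CodeFP (pairE unE (pairE unE (rawE (rawE giE)))) (rawE (rawE giE))
      (fun p => (List.range p.2.2.length).map fun r => (List.range p.2.1).map fun c =>
        entryOf (2 ^ p.1) (gsLevels p.2.2 p.2.1 (p.2.2.length + p.2.2.length)) p.2.1 p.2.2.length r c) := by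
    exact (houter.comp ((hctx.pair (urange.comp hn)).pair (urange.comp hm)) :)
  exact (hall.congr fun p => rfl :)

end Literature.Computability.QuantumComplexity
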